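import Literature.Barriers.AnomalousDissipation.ShearFlowViscositySelectionHolds
import Literature.Analysis.FluidPDE.NSStability2HalfD
import HarnessLib

/-!
# Bardos–Titi–Wiedemann 2012, Thm. 5 under perturbation of the data: the exact reach of the
viscosity-selection barrier (refuter barrier audit of `ShearFlowViscositySelectionSteps`,
2026-08-15)

Companion to `Literature/Barriers/AnomalousDissipation/ShearFlowViscositySelection.lean`
(barrier `BardosTitiWiedemann2012_thm5`, machine-checked in the tree as
`BardosTitiWiedemann2012_thm5_holds`) and to `ShearFlowViscositySelectionSteps.lean`, whose two
named facts (uniqueness among all Leray–Hopf solutions; the ansatz-form Leray–Hopf solution) are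
theorems (`…_uniqueness_holds`, `…_shearLerayHopf_holds`). The audit question "is the scope
narrower than claimed?" has one quantitative answer worth recording as a theorem: the selection
"every Leray–Hopf family with shear datum `v₀` converges weak-* to the shear flow" is printed —
and proved here — for Leray–Hopf families with **the same datum for every `ν`**. Bardos, Lopes
Filho, Niu, Nussenzveig Lopes and Titi themselves call that "too demanding" and define viscosity
solutions with data `u₀^ν → u₀` in `L²` (SIAM J. Math. Anal. 45 (2013), §4), proving symmetry
retention only when `‖u₀ - u₀^ν‖ = o(e^{-C/ν⁴})`, `C ≥ 27‖u₀‖⁴/64` (op. cit., Thm. 4.4), because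
the only available stability constant is that of their Thm. 3.1, `exp(27‖u₀‖⁴_{L²}/(64ν⁴))`.

## This file (theorem-only)

* `BardosTitiWiedemann2012_thm5_perturbedData` — **the perturbed-data reach of the barrier,
  proved**: for shear data `v₀ = (v₁(x₂),0,v₃(x₁,x₂))`, `v₁ ∈ L²(T)`, `v₃ ∈ L²(T²)`, `T > 0`,
  `ν_j → 0`, and ANY Leray–Hopf solutions `u_j` (viscosity `ν_j`) with `L²` data `u₀ʲ` such that
  `‖u₀ʲ - v₀‖₂² · exp(ν_j T + 162 C² ‖v₀‖₂² / ν_j²) → 0` (`C = Torus.anisotropicConst`), the `u_j`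
  converge weak-* in `L^∞(0,T;L²(T³))` to the shear flow. Proof: the torus form of BLNNT Thm. 3.1
  (`Torus.IsLerayHopfOn.integral_norm_sub_sq_le_mul_exp_of_invariant`, `NSStability2HalfD`)
  against the exact-datum shear Leray–Hopf family (`BardosTitiWiedemann2012_thm5_shearLerayHopf_global`),
  which converges by `BardosTitiWiedemann2012_thm5_holds`; weak-* limits are stable under
  perturbations vanishing in `L^∞_t L²_x`. Its docstring carries the BARRIER block.
* Pairing glue ([folklore]): `integral_norm_le_sqrt`, `norm_integral_inner_le_mul_sqrt`,
  `exists_norm_le_of_isSpaceTimeTest`, `integrableOn_integral_inner_test`,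
  `integrable_inner_of_memLp_of_continuous`.

What is NOT here: anything about data converging more slowly than the modulus, BLNNT Thm. 4.4
for general `x₃`-independent data (only the shear case, where the limit is identified), forces,
or non-Leray weak solutions. **Gen-4 audit (2026-08-15):** for the data of block (i) of the
barrier — the flat vortex sheet and every parallel shear datum `(v₁(x₂),0,0)` with Fourier
coefficients `|k₂||v̂₁(k₂)| ≤ M` — the modulus improves from `exp(-c/ν²)` to the
Kelvin–Helmholtz scale: families with `‖u₀ʲ - v₀‖₂² exp(4M√(πT/ν_j)) → 0` still select the
shear flow (`BardosTitiWiedemann2012_thm5_perturbedData_sheet`, proved in the sibling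
`ShearFlowViscositySelectionPerturbedSheet.lean`: relative energy against the Lipschitz heat-flow
shear, whose `ℓ¹`-Fourier gradient budget `M√(π/(νs))` is `L¹(0,T)`). The `evasions_known`
line below is corrected accordingly; no declaration of this file changed.

## References

* C. Bardos, E. S. Titi, E. Wiedemann, C. R. Math. Acad. Sci. Paris 350 (2012) 757–760,
  Thm. 5 and its proof ("this solution depends continuously on the initial data … (see
  [BLNNT])"). [BardosTitiWiedemann2012]
* C. Bardos, M. C. Lopes Filho, D. Niu, H. J. Nussenzveig Lopes, E. S. Titi, SIAM J. Math.
  Anal. 45 (2013) 1871–1885 = arXiv:1201.2742, Thm. 3.1, §4 (viscosity solutions with perturbed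
  data: "insisting that viscosity solutions be limits … with exactly the same data might be too
  demanding"), Thm. 4.4. [BardosEtAl2013]
* D. Albritton, M. Colombo, G. Mescolini, arXiv:2507.19257, Thm. 1.1 (threshold `ε ~ ν^{κ_c}`
  in Vishik's forced scenario). [AlbrittonColomboMescolini2025]
* S. Thalabard, J. Bec, A. A. Mailybaev, Commun. Phys. 3 (2020) (vortex sheet, `ε ∝ ν`).
  [ThalabardBecMailybaev2020]
* K. Kalinin, G. Menon, B. Wu, arXiv:2410.14557, Thm. 1 (scale-invariant mixing-layer bounds).
  [KalininMenonWu2024]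
-/

open MeasureTheory Set Filter Topology UnitAddTorus Function
open scoped ENNReal NNReal InnerProductSpace

noncomputable section

namespace Literature.Barriers.AnomalousDissipation

open Literature.Analysis.FluidPDE Literature.Analysis.FunctionSpaces

/-! ## Pairing estimates -/

/-- `∫‖w‖ ≤ (∫‖w‖²)^{1/2}` on the (probability) torus, for `w ∈ L²` (Cauchy–Schwarz, through
`0 ≤ ∫ (‖w‖ - ∫‖w‖)²`). [folklore] -/
theorem integral_norm_le_sqrt {w : UnitAddTorus (Fin 3) → EuclideanSpace ℝ (Fin 3)} (hw : MemLp w 2 volume) :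
    ∫ x, ‖w x‖ ≤ Real.sqrt (∫ x, ‖w x‖ ^ 2) := by
  set a : ℝ := ∫ x, ‖w x‖ with ha
  have ha0 : 0 ≤ a := integral_nonneg fun _ => norm_nonneg _
  have i1 : Integrable (fun x => ‖w x‖) volume := (hw.integrable one_le_two).norm
  have i2 : Integrable (fun x => ‖w x‖ ^ 2) volume := hw.integrable_norm_pow two_ne_zero
  have h0 : 0 ≤ ∫ x, (‖w x‖ - a) ^ 2 := integral_nonneg fun _ => sq_nonneg _
  have hexp : ∫ x, (‖w x‖ - a) ^ 2 = (∫ x, ‖w x‖ ^ 2) - a ^ 2 := by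
    have : (fun x => (‖w x‖ - a) ^ 2) = fun x => (‖w x‖ ^ 2 - (2 * a) * ‖w x‖) + a ^ 2 := by
      funext x; ring
    rw [this, integral_add (f := fun x => ‖w x‖ ^ 2 - (2 * a) * ‖w x‖) (g := fun _ => a ^ 2)
        (i2.sub (i1.const_mul _)) (integrable_const _),
      integral_sub (f := fun x => ‖w x‖ ^ 2) (g := fun x => (2 * a) * ‖w x‖) i2 (i1.const_mul _),
      integral_const_mul, integral_const, probReal_univ, one_smul, ← ha]
    ring
  refine (Real.le_sqrt ha0 (integral_nonneg fun _ => sq_nonneg _)).2 ?_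
  linarith

/-- **Slice pairing bound**: `|∫⟪w, φ⟫| ≤ M (∫‖w‖²)^{1/2}` for `w ∈ L²(T³)` and `‖φ‖ ≤ M`
pointwise. [folklore] -/
theorem norm_integral_inner_le_mul_sqrt {w φ : UnitAddTorus (Fin 3) → EuclideanSpace ℝ (Fin 3)} (hw : MemLp w 2 volume) {M : ℝ}
    (hφM : ∀ x, ‖φ x‖ ≤ M) :
    ‖∫ x, ⟪w x, φ x⟫_ℝ‖ ≤ M * Real.sqrt (∫ x, ‖w x‖ ^ 2) := by
  have hM : 0 ≤ M := (norm_nonneg _).trans (hφM 0)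
  calc ‖∫ x, ⟪w x, φ x⟫_ℝ‖ ≤ ∫ x, ‖w x‖ * M :=
        norm_integral_le_of_norm_le ((hw.integrable one_le_two).norm.mul_const M)
          (ae_of_all _ fun x => (norm_inner_le_norm _ _).trans
            (mul_le_mul_of_nonneg_left (hφM x) (norm_nonneg _)))
    _ = M * ∫ x, ‖w x‖ := by rw [integral_mul_const, mul_comm]
    _ ≤ M * Real.sqrt (∫ x, ‖w x‖ ^ 2) := mul_le_mul_of_nonneg_left (integral_norm_le_sqrt hw) hM

/-- **A space–time test field is bounded on `[0,T] × T³`.** [folklore] -/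
theorem exists_norm_le_of_isSpaceTimeTest {T : ℝ} {ψ : ℝ → UnitAddTorus (Fin 3) → EuclideanSpace ℝ (Fin 3)}
    (hψ : Torus.IsSpaceTimeTest T ψ) : ∃ M : ℝ, 0 ≤ M ∧ ∀ t ∈ Icc 0 T, ∀ x, ‖ψ t x‖ ≤ M := by
  obtain ⟨K, hK⟩ := Torus.exists_norm_le_of_continuousOn_of_isCompact (S := univ)
    hψ.1.continuous.continuousOn isCompact_Icc (subset_univ (Icc (0 : ℝ) T))
  exact ⟨max K 0, le_max_right _ _, fun t ht x => (hK t ht x).trans (le_max_left _ _)⟩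

/-- **The slice pairing of an unforced Leray–Hopf solution with a test field is integrable in
time** on `(0,T)` (Fubini measurability and the uniform energy bound). [folklore] -/
theorem integrableOn_integral_inner_test {T ν : ℝ} {U : ℝ → UnitAddTorus (Fin 3) → EuclideanSpace ℝ (Fin 3)} {U₀ : UnitAddTorus (Fin 3) → EuclideanSpace ℝ (Fin 3)}
    (hU : Torus.IsLerayHopfOn T ν 0 U₀ U) (hν : 0 ≤ ν) {ψ : ℝ → UnitAddTorus (Fin 3) → EuclideanSpace ℝ (Fin 3)}
    (hψ : Torus.IsSpaceTimeTest T ψ) :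
    IntegrableOn (fun t => ∫ x, ⟪U t x, ψ t x⟫_ℝ) (Ioo 0 T) := by
  obtain ⟨M, hM0, hM⟩ := exists_norm_le_of_isSpaceTimeTest hψ
  have hUm : AEStronglyMeasurable (uncurry U) ((volume.restrict (Ioo 0 T)).prod volume) :=
    hU.aestronglyMeasurable_uncurry
  have hψm : AEStronglyMeasurable (uncurry ψ) ((volume.restrict (Ioo 0 T)).prod volume) :=
    Torus.aestronglyMeasurable_uncurry_of_stLift_prod (S := Ioo 0 T) hψ.1.continuous.aestronglyMeasurable
  have hF : AEStronglyMeasurable (fun p : ℝ × UnitAddTorus (Fin 3) => ⟪U p.1 p.2, ψ p.1 p.2⟫_ℝ)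
      ((volume.restrict (Ioo 0 T)).prod volume) := hUm.inner hψm
  have hmeas : AEStronglyMeasurable (fun t => ∫ x, ⟪U t x, ψ t x⟫_ℝ) (volume.restrict (Ioo 0 T)) :=
    hF.integral_prod_right'
  refine IntegrableOn.of_bound measure_Ioo_lt_top hmeas (M * Real.sqrt (∫ x, ‖U₀ x‖ ^ 2)) ?_
  filter_upwards [ae_restrict_mem measurableSet_Ioo] with t ht
  have ht' : t ∈ Icc 0 T := Ioo_subset_Icc_self ht
  have hen := hU.integral_norm_sq_add_le_of_zero_force ht'
  have hdiss : 0 ≤ 2 * ν * (∫⁻ s in Ioo 0 t, Torus.eGradNormSq (U s)).toReal := by positivity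
  calc ‖∫ x, ⟪U t x, ψ t x⟫_ℝ‖ ≤ M * Real.sqrt (∫ x, ‖U t x‖ ^ 2) :=
        norm_integral_inner_le_mul_sqrt (hU.memLp t ht') (hM t ht')
    _ ≤ M * Real.sqrt (∫ x, ‖U₀ x‖ ^ 2) :=
        mul_le_mul_of_nonneg_left (Real.sqrt_le_sqrt (by linarith)) hM0

/-- Integrability of the slice pairing integrand `x ↦ ⟪w x, φ x⟫` for `w ∈ L²` and `φ`
continuous. [folklore] -/
theorem integrable_inner_of_memLp_of_continuous {w φ : UnitAddTorus (Fin 3) → EuclideanSpace ℝ (Fin 3)} (hw : MemLp w 2 volume)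
    (hφ : Continuous φ) {M : ℝ} (hφM : ∀ x, ‖φ x‖ ≤ M) :
    Integrable (fun x => ⟪w x, φ x⟫_ℝ) volume :=
  Integrable.mono' ((hw.integrable one_le_two).norm.mul_const M) (hw.1.inner hφ.aestronglyMeasurable)
    (ae_of_all _ fun x => (norm_inner_le_norm _ _).trans (mul_le_mul_of_nonneg_left (hφM x) (norm_nonneg _)))

/-! ## Viscosity selection under data perturbation: the exact reach of the barrier -/

/-- **Bardos–Titi–Wiedemann 2012, Thm. 5, for data converging to the shear datum faster than
the stability modulus** (the mechanism of Bardos–Lopes Filho–Niu–Nussenzveig Lopes–Titi 2013,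
Thm. 4.4, in the selection form of Bardos–Titi–Wiedemann 2012, Thm. 5; proved). Let
`v₀ = (v₁(x₂), 0, v₃(x₁,x₂))` with `v₁ ∈ L²(T)`, `v₃ ∈ L²(T²)`, let `T > 0`, `ν_j > 0`,
`ν_j → 0`, and let `u_j` be Leray–Hopf weak solutions of the unforced Navier–Stokes equations on
`T³ × [0,T)` with viscosity `ν_j` and data `u₀ʲ ∈ L²(T³)` (not necessarily of shear form) with
`‖u₀ʲ - v₀‖₂² · exp(ν_j T + 162 C² ‖v₀‖₂² / ν_j²) → 0`, `C = Torus.anisotropicConst`. Then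
`u_j ⇀* v` in `L^∞(0,T;L²(T³))`, `v(x,t) = (v₁(x₂), 0, v₃(x₁ - t v₁(x₂), x₂))` the shear flow
(accepted `Torus.TendstoWeakStar`).

BARRIER (D-0021):
- technique_class: viscosity-limit-realization-of-wild-solutions perturbed-data-vanishing-viscosity shear-flow-ansatz parallel-two-and-a-half-dimensional-data
- blocks: the perturbed-data ("viscosity solution" in the sense of [cite: BardosEtAl2013, §4]) extension of block (i) of `BardosTitiWiedemann2012_thm5`: realising a non-shear admissible Euler solution with shear datum `v₀` (e.g. the infinitely many admissible solutions for Székelyhidi's vortex-sheet profile [cite: BardosTitiWiedemann2012, Cor. 2]) as a weak-* limit of Leray–Hopf solutions `u_j` whose data `u₀ʲ → v₀` satisfy `‖u₀ʲ - v₀‖₂² exp(ν_jT + 162C²‖v₀‖₂²/ν_j²) → 0` — all such families still select the shear flow; this contains the exact-datum case [cite: BardosTitiWiedemann2012, Thm. 5] and is the torus form of the symmetry-retention theorem for `o(e^{-C/ν⁴})`-accurate data [cite: BardosEtAl2013, Thm. 4.4].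
- because: Serrin's cross-testing plus the anisotropic Ladyzhenskaya inequality give the difference inequality and, by Grönwall, `‖u(t)-U(t)‖₂² ≤ ‖u₀-U₀‖₂² exp(∫₀ᵗ(ν + 324C²ν⁻¹‖∇U‖₂²)) ≤ ‖u₀-U₀‖₂² exp(νt + 162C²‖U₀‖₂²/ν²)` for any Leray–Hopf `u` against an `x₃`-independent Leray–Hopf `U` [cite: BardosEtAl2013, Thm. 3.1 (proof)] (`Torus.IsLerayHopfOn.integral_norm_sub_sq_le_mul_exp_of_invariant`); applied with `U_j` the exact-datum shear Leray–Hopf family (`BardosTitiWiedemann2012_thm5_shearLerayHopf_global`), which converges weak-* to the shear flow [cite: BardosTitiWiedemann2012, Thm. 5] (`BardosTitiWiedemann2012_thm5_holds`), the hypothesis makes `sup_{t≤T}‖u_j(t)-U_j(t)‖₂ → 0`, and weak-* convergence is stable under such perturbations.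
- evasions_known: none inside the hypothesis. OUTSIDE it — data converging more slowly than the modulus, in particular at any algebraic rate `‖u₀^ν - v₀‖₂ ~ ν^a` or by generic three-dimensional perturbations of vanishing energy — nothing is printed either way for the shear/vortex-sheet class: the sources prove retention of two-dimensionality only under `‖u₀ - u₀^ν‖ = o(e^{-C/ν⁴})` and call the same-data requirement "too demanding" [cite: BardosEtAl2013, §4 and Thm. 4.4]; in Vishik's forced two-dimensional scenario a sharp threshold `ε ~ ν^{κ_c}` is a theorem (below: selection of the symmetric solution; at it: Navier–Stokes solutions converging along subsequences to non-unique non-symmetric Euler solutions) [cite: AlbrittonColomboMescolini2025, Thm. 1.1]; for the flat vortex sheet with perturbations `ε ∝ ν` vanishing in energy the computed inviscid limit is a spontaneously stochastic mixing layer of linearly growing width, not the steady shear [cite: ThalabardBecMailybaev2020], consistent with the rigorous uniform-in-Reynolds upper bounds `limsup l/(Ut) ≤ 1/(2√3)`, `limsup D/(U²t) ≤ 1/(4√3)` saturated by Székelyhidi's subsolution [cite: KalininMenonWu2024, Thm. 1 and Rem. 1–2]. Linear Kelvin–Helmholtz heuristics for the diffusing layer of width `√(νt)` (growth rate `~‖v₁‖_∞/√(νt)`,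 amplification `exp(c‖v₁‖_∞√(t/ν))`) put the expected true threshold at `exp(-c/√ν)`, far above this theorem's `exp(-c/ν²)` and far below algebraic rates. For the data of block (i) the modulus DOES improve to that scale (2026-08-15 audit, gen 4): for `v₃ = 0` and shear profiles with `|k₂||v̂₁(k₂)| ≤ M` (every profile of bounded variation, `M = TV(v₁)/(2π)`; the flat vortex sheet, `M = 2/π`), Leray–Hopf families with arbitrary `L²` data satisfying `‖u₀ʲ - v₀‖₂² exp(4M√(πT/ν_j)) → 0` select the shear flow — proved, `BardosTitiWiedemann2012_thm5_perturbedData_sheet` (`ShearFlowViscositySelectionPerturbedSheet`): the exact-datum reference solution is the heat-flow shear `(e^{νt∂₂²}v₁,0,0)`, Lipschitz for `t > 0` with `ℓ¹`-Fourier gradient budget `∑_k 2π|k|₁|Û(k,s)| ≤ M√(π/(νs)) ∈ L¹(0,T)`, so Serrin's relative energy inequality closes by Grönwall with exponent `4M√(πT/ν)` instead of the enstrophy budget `~‖v₀‖₂²/ν²`; since `∫₀ᵀ‖∇U‖_∞ ~ √(T/ν)` is also the integrated KH growth rate, Grönwall-type selection provably stops at `exp(-Θ(√(T/ν)))`, and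 what remains open is a rigorous NON-selection result for perturbations `exp(-o(√(T/ν)))` (in particular algebraic), together with the `v₃ ∈ L²` case at the improved scale (for Lipschitz `v₃` the same budget argument applies, unformalised).
- scope_caveats: `T³`, unforced, finite window `[0,T)`, `T > 0`; reference data exactly of parallel shear form with `v₁ ∈ L²(T)`, `v₃ ∈ L²(T²)` as in [cite: BardosTitiWiedemann2012, Thm. 5]; the perturbed data `u₀ʲ` are arbitrary `L²` fields (the Leray–Hopf hypothesis is vacuous unless they are weakly divergence free); Leray–Hopf in the strict house sense `Torus.IsLerayHopfOn` (energy inequality from `0`, weak continuity, strong attainment of the datum); the constant `162 C²`, `C = Torus.anisotropicConst` (inhomogeneous Ladyzhenskaya on `T²`), replaces the printed cylinder constant `27/(64ν⁴)·‖u₀‖⁴` — the `ν⁻²` versus `ν⁻⁴` difference is the inhomogeneous versus homogeneous interpolation, not an improvement of the method; weak-* convergence only (strong convergence and absence of anomalous dissipation, which hold in the exact-datum case, are not asserted here for the perturbed family).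
- status: established (theorem; proved in this file from `BardosTitiWiedemann2012_thm5_holds` and the torus form of [cite: BardosEtAl2013, Thm. 3.1]) [cite: BardosEtAl2013, Thm. 3.1 and Thm. 4.4] [cite: BardosTitiWiedemann2012, Thm. 5] -/
theorem BardosTitiWiedemann2012_thm5_perturbedData
    (v₁ : UnitAddCircle → ℝ) (hv₁ : MemLp v₁ 2 volume) (v₃ : UnitAddTorus (Fin 2) → ℝ)
    (hv₃ : MemLp v₃ 2 volume) {T : ℝ} (hT : 0 < T) (ν : ℕ → ℝ) (hν : ∀ j, 0 < ν j)
    (hν₀ : Tendsto ν atTop (𝓝 0)) (u₀ : ℕ → UnitAddTorus (Fin 3) → EuclideanSpace ℝ (Fin 3)) (hu₀ : ∀ j, MemLp (u₀ j) 2 volume)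
    (u : ℕ → ℝ → UnitAddTorus (Fin 3) → EuclideanSpace ℝ (Fin 3)) (hu : ∀ j, Torus.IsLerayHopfOn T (ν j) 0 (u₀ j) (u j))
    (hclose : Tendsto (fun j => (∫ x, ‖u₀ j x - shearData v₁ v₃ x‖ ^ 2) *
        Real.exp (ν j * T + 162 * Torus.anisotropicConst.toReal ^ 2 / ν j ^ 2 *
          ∫ x, ‖shearData v₁ v₃ x‖ ^ 2)) atTop (𝓝 0)) :
    Torus.TendstoWeakStar u (shearFlow v₁ v₃) T := by
  set v₀ : UnitAddTorus (Fin 3) → EuclideanSpace ℝ (Fin 3) := shearData v₁ v₃ with hv₀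
  have hv₀m : MemLp v₀ 2 volume := memLp_shearData hv₁ hv₃
  -- ### the exact-datum shear Leray–Hopf family and Thm. 5 (iii) for it
  choose a c hU using fun j => BardosTitiWiedemann2012_thm5_shearLerayHopf_global v₁ hv₁ v₃ hv₃ (hν j)
  set U : ℕ → ℝ → UnitAddTorus (Fin 3) → EuclideanSpace ℝ (Fin 3) := fun j t x => !₂[a j t (x 1), 0, c j t ![x 0, x 1]] with hUdef
  have hUT : ∀ j, Torus.IsLerayHopfOn T (ν j) 0 v₀ (U j) := fun j => hU j T hT
  have hUinv : ∀ j (t : ℝ) (s : UnitAddCircle) (x : UnitAddTorus (Fin 3)), U j t (x + Pi.single (2 : Fin 3) s) = U j t x := by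
    intro j t s x; simp [hUdef]
  have h5 : Torus.TendstoWeakStar U (shearFlow v₁ v₃) T :=
    (BardosTitiWiedemann2012_thm5_holds v₁ hv₁ v₃ hv₃ T hT).2 ν hν hν₀ U hUT
  -- ### the stability moduli `δ j`
  set δ : ℕ → ℝ := fun j => (∫ x, ‖u₀ j x - v₀ x‖ ^ 2) *
      Real.exp (ν j * T + 162 * Torus.anisotropicConst.toReal ^ 2 / ν j ^ 2 * ∫ x, ‖v₀ x‖ ^ 2) with hδ
  have hδlim : Tendsto δ atTop (𝓝 0) := hclose
  have hexp1 : ∀ j, 1 ≤ Real.exp (ν j * T + 162 * Torus.anisotropicConst.toReal ^ 2 / ν j ^ 2 * ∫ x, ‖v₀ x‖ ^ 2) :=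
    fun j => Real.one_le_exp (add_nonneg (mul_nonneg (hν j).le hT.le) (mul_nonneg
      (div_nonneg (by positivity) (sq_nonneg _)) (integral_nonneg fun _ => sq_nonneg _)))
  have hstab : ∀ j, ∀ t ∈ Ioc 0 T, ∫ x, ‖u j t x - U j t x‖ ^ 2 ≤ δ j := by
    intro j t ht
    refine ((hu j).integral_norm_sub_sq_le_mul_exp_of_invariant (hUT j) (hν j) hT (hu₀ j) hv₀m (hUinv j) ht).trans ?_
    have hνj := (hν j).le
    have htT : ν j * t ≤ ν j * T := mul_le_mul_of_nonneg_left ht.2 hνj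
    exact mul_le_mul_of_nonneg_left (Real.exp_le_exp.2 (by linarith)) (integral_nonneg fun _ => sq_nonneg _)
  obtain ⟨D, hD⟩ : ∃ D : ℝ, ∀ j, δ j ≤ D := by
    obtain ⟨D, hD⟩ := hδlim.bddAbove_range
    exact ⟨D, fun j => hD ⟨j, rfl⟩⟩
  have hdat : ∀ j, ∫ x, ‖u₀ j x - v₀ x‖ ^ 2 ≤ D := fun j =>
    (le_mul_of_one_le_right (integral_nonneg fun _ => sq_nonneg _) (hexp1 j)).trans (hD j)
  refine ⟨?_, fun ψ hψ => ?_⟩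
  · -- ### uniform `L^∞_t L²_x` bound
    set Ce : ℝ≥0∞ := 2 * ENNReal.ofReal D + 2 * ∫⁻ x, ‖v₀ x‖ₑ ^ 2 with hCe
    have hv₀fin : ∫⁻ x, ‖v₀ x‖ₑ ^ 2 ≠ ⊤ := by
      rw [Torus.lintegral_enorm_sq_eq_ofReal hv₀m]; exact ENNReal.ofReal_ne_top
    have hCetop : Ce ≠ ⊤ := ENNReal.add_ne_top.2 ⟨ENNReal.mul_ne_top ENNReal.ofNat_ne_top ENNReal.ofReal_ne_top,
      ENNReal.mul_ne_top ENNReal.ofNat_ne_top hv₀fin⟩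
    refine ⟨Ce.toNNReal, fun m => ?_⟩
    rw [ENNReal.coe_toNNReal hCetop]
    filter_upwards [ae_restrict_mem measurableSet_Ioo] with t ht
    have ht' : t ∈ Icc 0 T := Ioo_subset_Icc_self ht
    have hmeas : AEMeasurable (fun x => ‖u₀ m x - v₀ x‖ₑ ^ 2) volume :=
      ((hu₀ m).sub hv₀m).aestronglyMeasurable.enorm.pow_const _
    calc ∫⁻ x, ‖u m t x‖ₑ ^ 2 ≤ ∫⁻ x, ‖u₀ m x‖ₑ ^ 2 :=
          lintegral_enorm_sq_le_of_isLerayHopfOn (hν m).le (hu m) (hu₀ m) ht'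
      _ ≤ ∫⁻ x, (2 * ‖u₀ m x - v₀ x‖ₑ ^ 2 + 2 * ‖v₀ x‖ₑ ^ 2) := lintegral_mono fun x => enorm_sq_le_two_mul_add _ _
      _ = 2 * (∫⁻ x, ‖u₀ m x - v₀ x‖ₑ ^ 2) + 2 * ∫⁻ x, ‖v₀ x‖ₑ ^ 2 := by
          rw [lintegral_add_left' (hmeas.const_mul _), lintegral_const_mul' _ _ ENNReal.ofNat_ne_top,
            lintegral_const_mul' _ _ ENNReal.ofNat_ne_top]
      _ ≤ Ce := by
          rw [hCe]
          gcongr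
          have h := Torus.lintegral_enorm_sq_eq_ofReal ((hu₀ m).sub hv₀m)
          simp only [Pi.sub_apply] at h
          rw [h]
          exact ENNReal.ofReal_le_ofReal (hdat m)
  · -- ### convergence against a test field
    obtain ⟨M, hM0, hM⟩ := exists_norm_le_of_isSpaceTimeTest hψ.1
    have hconvU := h5.2 ψ hψ
    have hvol : volume.real (Ioo (0 : ℝ) T) = T := by rw [Real.volume_real_Ioo_of_le hT.le, sub_zero]
    have hbound : ∀ j, ‖(∫ t in Ioo 0 T, ∫ x, ⟪u j t x, ψ t x⟫_ℝ) - ∫ t in Ioo 0 T, ∫ x, ⟪U j t x, ψ t x⟫_ℝ‖ ≤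
        M * Real.sqrt (δ j) * T := by
      intro j
      rw [← integral_sub (integrableOn_integral_inner_test (hu j) (hν j).le hψ.1)
        (integrableOn_integral_inner_test (hUT j) (hν j).le hψ.1)]
      calc ‖∫ t in Ioo 0 T, ((∫ x, ⟪u j t x, ψ t x⟫_ℝ) - ∫ x, ⟪U j t x, ψ t x⟫_ℝ)‖
          ≤ (M * Real.sqrt (δ j)) * volume.real (Ioo (0 : ℝ) T) := by
            refine norm_setIntegral_le_of_norm_le_const measure_Ioo_lt_top fun t ht => ?_
            have ht' : t ∈ Icc 0 T := Ioo_subset_Icc_self ht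
            have hut : MemLp (u j t) 2 volume := (hu j).memLp t ht'
            have hUt : MemLp (U j t) 2 volume := (hUT j).memLp t ht'
            have hψc : Continuous (ψ t) := (hψ.1.isSmooth_slice t).continuous
            rw [← integral_sub (integrable_inner_of_memLp_of_continuous hut hψc (hM t ht'))
              (integrable_inner_of_memLp_of_continuous hUt hψc (hM t ht'))]
            simp_rw [← inner_sub_left]
            calc ‖∫ x, ⟪u j t x - U j t x, ψ t x⟫_ℝ‖ ≤ M * Real.sqrt (∫ x, ‖u j t x - U j t x‖ ^ 2) :=
                  norm_integral_inner_le_mul_sqrt (hut.sub hUt) (hM t ht')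
              _ ≤ M * Real.sqrt (δ j) :=
                  mul_le_mul_of_nonneg_left (Real.sqrt_le_sqrt (hstab j t ⟨ht.1, ht.2.le⟩)) hM0
        _ = M * Real.sqrt (δ j) * T := by rw [hvol]
    have hlim0 : Tendsto (fun j => M * Real.sqrt (δ j) * T) atTop (𝓝 0) := by
      have h1 : Tendsto (fun j => Real.sqrt (δ j)) atTop (𝓝 0) := by
        have := (Real.continuous_sqrt.tendsto 0).comp hδlim
        rwa [Real.sqrt_zero] at this
      simpa using (h1.const_mul M).mul_const T
    have hdiff := squeeze_zero_norm hbound hlim0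
    have := hconvU.add hdiff
    rw [add_zero] at this
    refine this.congr fun j => ?_
    ring


end Literature.Barriers.AnomalousDissipation

end
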